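import Literature.Probability.FitznerVanDerHofstad2017.NobleLenIdxEvents
import Literature.Probability.FitznerVanDerHofstad2017.LabelledDisjointOccurrence
import Literature.Probability.FitznerVanDerHofstad2017.RepulsiveTriangleExtractionIndep

/-!
# [FvdH17] §4.2 Def. 4.1, (4.12), (4.16)–(4.17): the PERCOLATION LETTERS — the `Letters d` instance
`Letters.perc d p` with lower indices in `{0̲,1̲,…} ∪ {0,1,…}` (`LenIdx`)

Source: R. Fitzner, R. van der Hofstad, *Mean-field behavior for nearest-neighbor percolation in `d > 10`*,
Electron. J. Probab. **22** (2017) no. 43 [FvdH17], §4.2 (arXiv:1506.07977v2 pp. 34–36 = EJP pp. 31–33):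

* Def. 4.1 (generalized disjoint occurrence `⊛` on `n` independent configurations): "Similar definitions apply to
  connections of the form `{x_i ←j_i→ y_i}_i` for indices `j_i ∈ {0̲,1̲,…} ∪ {0,1,…}`."
* (4.16)–(4.17): "For `x_i ∈ ℤ^d` and indices `j_i ∈ {0̲,1̲,…} ∪ {0,1,…}`, we define the repulsive bubble and triangle
  to be `𝓑_{j₁,j₂}(x₁,x₂) = max_{i=1,2} ℙ_p({0 ←j₁→ x₁}₁ ⊛ {x₁ ←j₂→ x₂}_i)`,
  `𝓣_{j₁,j₂,j₃}(x₁,x₂,x₃) = max_{(i,j) ∈ {1,2,3}²} ℙ_p({0 ←j₁→ x₁}₁ ⊛ {x₁ ←j₂→ x₂}_i ⊛ {x₂ ←j₃→ x₃}_j)`, where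
  `ω₁,ω₂,ω₃` are three i.i.d. percolation configurations under `ℙ_p`.  The repulsive square
  `𝓢_{j₁,j₂,j₃,j₄}(x₁,x₂,x₃,x₄)` and pentagon `𝓟_{j₁,…,j₅}(x₁,…,x₅)` are defined in the same manner. We omit the
  formal definitions of these diagrams."
* (4.12): `𝓓_{j₁,j₂}(x) = ℙ_p({0 ←j₁→ x} ∘ {0 ←j₂→ x})`; (4.10)/(4.1): `τ_{j,p}(x)`; `ℙ_p(0 ⇔ x)` (double connection).

## What this module does

It CONSTRUCTS the instance `Letters.perc d p : NobleBlocks.Letters d` of the letter bundle of `NobleBlocks` (the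
bundle itself carries no axioms) from bond percolation on `ℤ^d`, in the tree's WITNESS / PATH reading:
`τ_j(x) = ℙ_p(0 ←j→ x)` (`LenIdx.event`, `NobleLenIdxEvents`), `ℙ_p(0 ⇔ x) = ℙ_p({0 ↔ x} ∘ {0 ↔ x})`,
`𝓓_{j₁,j₂}(x) = ℙ_p({0 ←j₁→ x} ∘ {0 ←j₂→ x})`, and the repulsive bubble / triangle / square / pentagon as the
MAXIMUM over the configuration assignments `c` with `c₁ = 1` (line `1` on configuration `1`, the other lines free,
`n` lines on `n` i.i.d. configurations — "in the same manner") of `ℙ_p^{⊗n}(⊛_i ({x_{i-1} ←j_i→ x_i})_{c_i})`, the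
labelled disjoint occurrence `genDisjOcc` of `LabelledDisjointOccurrence` applied to the `LenIdx` line events
(`repLetter`).  All values in `[0,∞]` (measures of events, each `≤ 1`).

Proved here: every letter is `≤ 1`; MONOTONICITY in the indices — replacing an index `j` by the at-least index
`⌊j⌋` (`LenIdx.floor`: `m̲ ↦ m`, `m ↦ m`) can only increase a letter (`{v ←m̲→ x} ⊆ {v ←m→ x}`), so every upper
bound proved for at-least letters transfers to exact-length letters; the BK / product bounds (4.14)–(4.15)
`𝓑 ≤ 𝓑*`, `𝓣 ≤ 𝓣*`, `𝓢 ≤ 𝓢*` (non-repulsive letters of `NobleBlocks.Letters.Bst/Tst/Sst`, via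
`pi_real_genDisjOcc_le_prod`); and the DICTIONARY with the tree's at-least-indexed diagrams:
`τ_{(m)}` = `tauLetter`/`tauGe`, `𝓓_{m₁,m₂} = NobleBoundsN0.diagDT`, `𝓣_{m₁,m₂,m₃} = ofReal (repTriangle)`
(`RepulsiveTriangleExtractionIndep`, the same maximum over `{1,2,3}²`).  The bubble dictionary with
`GeneralizedDisjointOccurrence.repBubble` (typed on `ℙ_p ⊗ ℙ_p` rather than `ℙ_p^{⊗2}` on `Fin 2 → _`) and the square /
pentagon extraction bounds are NOT proved here.  Nothing in this module is a cited hypothesis; no statement about any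
particular dimension is made.
-/

noncomputable section

namespace Literature.Probability.FitznerVanDerHofstad2017.NobleBlocks

open _root_.MeasureTheory Literature.Probability.LatticeModels Literature.Probability.Percolation
open Literature.Probability.FitznerVanDerHofstad2017.NobleBlocks.LenIdx
open scoped BigOperators ENNReal

variable {d : ℕ}

/-! ### A. `n` i.i.d. configurations and the repulsive letter of a list of line events -/

/-- `ℙ_p^{⊗n}`: `n` independent percolation configurations on `ℤ^d` ("`ω₁,ω₂,ω₃` are three i.i.d. percolation
configurations under `ℙ_p`"). [cite: FitznerVanDerHofstad2017, §4.2 Def. 4.1 (arXiv:1506.07977v2 p. 35)] -/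
def piPerc (d : ℕ) (p : unitInterval) (n : ℕ) : Measure (Fin n → BondConfig (Site d)) :=
  Measure.pi fun _ : Fin n => bondPercolation (zdGraph d) p

/-- `ℙ_p^{⊗n}` is a probability measure. [folklore] -/
instance piPerc.instIsProbabilityMeasure (p : unitInterval) (n : ℕ) : IsProbabilityMeasure (piPerc d p n) := by
  unfold piPerc; infer_instance

/-- `ℙ_p^{⊗n}(E) ≤ 1`. [folklore] -/
theorem piPerc_le_one (p : unitInterval) (n : ℕ) (E : Set (Fin n → BondConfig (Site d))) : piPerc d p n E ≤ 1 :=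
  prob_le_one

/-- The configuration assignments of the maxima in (4.16)–(4.17): line `1` on configuration `1` (`c 0 = 0` with
`0`-based labels), the other lines free. [cite: FitznerVanDerHofstad2017, §4.2 (4.16)–(4.17) (arXiv:1506.07977v2 p. 36)] -/
def assignments (n : ℕ) : Finset (Fin (n + 1) → Fin (n + 1)) := Finset.univ.filter fun c => c 0 = 0

/-- Membership in `assignments` (definitional). [folklore] -/
theorem mem_assignments_iff {n : ℕ} (c : Fin (n + 1) → Fin (n + 1)) : c ∈ assignments n ↔ c 0 = 0 := by
  simp [assignments]

/-- **The repulsive letter of `n+1` line events `A₀,…,A_n`**: `max_{c : c₁ = 1} ℙ_p^{⊗(n+1)}(⊛_i (A_i)_{c_i})`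
((4.16): `n+1 = 2`; (4.17): `n+1 = 3`; square `4`, pentagon `5` "in the same manner").
[cite: FitznerVanDerHofstad2017, §4.2 (4.16)–(4.17) (arXiv:1506.07977v2 p. 36)] -/
def repLetter (d : ℕ) (p : unitInterval) {n : ℕ} (A : Fin (n + 1) → Set (BondConfig (Site d))) : ℝ≥0∞ :=
  (assignments n).sup fun c => piPerc d p (n + 1) (genDisjOcc A c)

/-- Each member of the maximum is below the repulsive letter. [cite: FitznerVanDerHofstad2017, §4.2 (4.16)–(4.17) (arXiv:1506.07977v2 p. 36)] -/
theorem piPerc_genDisjOcc_le_repLetter (p : unitInterval) {n : ℕ} (A : Fin (n + 1) → Set (BondConfig (Site d)))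
    {c : Fin (n + 1) → Fin (n + 1)} (hc : c 0 = 0) : piPerc d p (n + 1) (genDisjOcc A c) ≤ repLetter d p A :=
  Finset.le_sup (f := fun c => piPerc d p (n + 1) (genDisjOcc A c)) ((mem_assignments_iff c).2 hc)

/-- `repLetter ≤ 1`. [folklore] -/
theorem repLetter_le_one (p : unitInterval) {n : ℕ} (A : Fin (n + 1) → Set (BondConfig (Site d))) :
    repLetter d p A ≤ 1 :=
  Finset.sup_le fun _ _ => piPerc_le_one p _ _

/-- Monotonicity of the repulsive letter in the line events. [folklore] -/
theorem repLetter_mono (p : unitInterval) {n : ℕ} {A B : Fin (n + 1) → Set (BondConfig (Site d))}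
    (h : ∀ i, A i ⊆ B i) : repLetter d p A ≤ repLetter d p B :=
  Finset.sup_mono_fun fun c _ => measure_mono (genDisjOcc_mono h c)

/-- **(4.14)–(4.15) for the repulsive letter**: `max_c ℙ_p^{⊗(n+1)}(⊛_i (A_i)_{c_i}) ≤ ∏_i ℙ_p(A_i)` for increasing
finitary line events. [cite: FitznerVanDerHofstad2017, §4.2 (4.14)–(4.15) (arXiv:1506.07977v2 p. 35)] -/
theorem repLetter_le_prod (p : unitInterval) {n : ℕ} (A : Fin (n + 1) → Set (BondConfig (Site d)))
    (hA : ∀ i, IsUpperSet (A i)) (hF : ∀ i, IsFinitary (A i)) :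
    repLetter d p A ≤ ∏ i, bondPercolation (zdGraph d) p (A i) := by
  refine Finset.sup_le fun c _ => ?_
  have h := pi_real_genDisjOcc_le_prod (zdGraph d) p A c hA hF
  have h1 : piPerc d p (n + 1) (genDisjOcc A c) = ENNReal.ofReal ((piPerc d p (n + 1)).real (genDisjOcc A c)) :=
    (ofReal_measureReal (measure_ne_top _ _)).symm
  rw [h1]
  calc ENNReal.ofReal ((piPerc d p (n + 1)).real (genDisjOcc A c))
      ≤ ENNReal.ofReal (∏ i, (bondPercolation (zdGraph d) p).real (A i)) := ENNReal.ofReal_le_ofReal h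
    _ = ∏ i, ENNReal.ofReal ((bondPercolation (zdGraph d) p).real (A i)) :=
        ENNReal.ofReal_prod_of_nonneg fun i _ => measureReal_nonneg
    _ = ∏ i, bondPercolation (zdGraph d) p (A i) :=
        Finset.prod_congr rfl fun i _ => ofReal_measureReal (measure_ne_top _ _)

/-! ### B. The line events of the bubble, triangle, square and pentagon -/

/-- Lines `{0 ←j₁→ x₁}, {x₁ ←j₂→ x₂}` of (4.16). [cite: FitznerVanDerHofstad2017, §4.2 (4.16) (arXiv:1506.07977v2 p. 36)] -/
def lineEvents₂ (j₁ j₂ : LenIdx) (x₁ x₂ : Site d) : Fin 2 → Set (BondConfig (Site d)) :=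
  ![event j₁ 0 x₁, event j₂ x₁ x₂]

/-- Lines `{0 ←j₁→ x₁}, {x₁ ←j₂→ x₂}, {x₂ ←j₃→ x₃}` of (4.17). [cite: FitznerVanDerHofstad2017, §4.2 (4.17) (arXiv:1506.07977v2 p. 36)] -/
def lineEvents₃ (j₁ j₂ j₃ : LenIdx) (x₁ x₂ x₃ : Site d) : Fin 3 → Set (BondConfig (Site d)) :=
  ![event j₁ 0 x₁, event j₂ x₁ x₂, event j₃ x₂ x₃]

/-- Lines of the repulsive square `𝓢_{j₁,…,j₄}(x₁,…,x₄)` ("defined in the same manner").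
[cite: FitznerVanDerHofstad2017, §4.2, sentence after (4.17) (arXiv:1506.07977v2 p. 36)] -/
def lineEvents₄ (j₁ j₂ j₃ j₄ : LenIdx) (x₁ x₂ x₃ x₄ : Site d) : Fin 4 → Set (BondConfig (Site d)) :=
  ![event j₁ 0 x₁, event j₂ x₁ x₂, event j₃ x₂ x₃, event j₄ x₃ x₄]

/-- Lines of the repulsive pentagon `𝓟_{j₁,…,j₅}(x₁,…,x₅)` ("defined in the same manner").
[cite: FitznerVanDerHofstad2017, §4.2, sentence after (4.17) (arXiv:1506.07977v2 p. 36)] -/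
def lineEvents₅ (j₁ j₂ j₃ j₄ j₅ : LenIdx) (x₁ x₂ x₃ x₄ x₅ : Site d) : Fin 5 → Set (BondConfig (Site d)) :=
  ![event j₁ 0 x₁, event j₂ x₁ x₂, event j₃ x₂ x₃, event j₄ x₃ x₄, event j₅ x₄ x₅]

/-! ### C. The instance -/

/-- **The percolation letters `Letters.perc d p`** — `p`, `τ_{j,p}(x) = ℙ_p(0 ←j→ x)`, `ℙ_p(0 ⇔ x)`,
`𝓓_{j₁,j₂}(x)`, and the repulsive `𝓑, 𝓣, 𝓢, 𝓟` of Def. 4.1 / (4.12) / (4.16)–(4.17) with indices in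
`{0̲,1̲,…} ∪ {0,1,…}`, in `[0,∞]`.
[cite: FitznerVanDerHofstad2017, §4.2 (4.10), (4.12), Def. 4.1, (4.16)–(4.17) (arXiv:1506.07977v2 pp. 35–36)] -/
def Letters.perc (d : ℕ) (p : unitInterval) : Letters d where
  p := ENNReal.ofReal p
  tau j x := bondPercolation (zdGraph d) p (event j 0 x)
  dbc x := bondPercolation (zdGraph d) p (openConn 0 x □ openConn 0 x)
  D j₁ j₂ x := bondPercolation (zdGraph d) p (event j₁ 0 x □ event j₂ 0 x)
  B j₁ j₂ x₁ x₂ := repLetter d p (lineEvents₂ j₁ j₂ x₁ x₂)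
  T j₁ j₂ j₃ x₁ x₂ x₃ := repLetter d p (lineEvents₃ j₁ j₂ j₃ x₁ x₂ x₃)
  S j₁ j₂ j₃ j₄ x₁ x₂ x₃ x₄ := repLetter d p (lineEvents₄ j₁ j₂ j₃ j₄ x₁ x₂ x₃ x₄)
  P j₁ j₂ j₃ j₄ j₅ x₁ x₂ x₃ x₄ x₅ := repLetter d p (lineEvents₅ j₁ j₂ j₃ j₄ j₅ x₁ x₂ x₃ x₄ x₅)

section Unfold

variable (p : unitInterval)

/-- Unfolding `p`. [folklore] -/
theorem perc_p : (Letters.perc d p).p = ENNReal.ofReal p := rfl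
/-- Unfolding `τ_j`. [folklore] -/
theorem perc_tau (j : LenIdx) (x : Site d) : (Letters.perc d p).tau j x = bondPercolation (zdGraph d) p (event j 0 x) := rfl
/-- Unfolding `ℙ_p(0 ⇔ x)`. [folklore] -/
theorem perc_dbc (x : Site d) :
    (Letters.perc d p).dbc x = bondPercolation (zdGraph d) p (openConn 0 x □ openConn 0 x) := rfl
/-- Unfolding `𝓓`. [folklore] -/
theorem perc_D (j₁ j₂ : LenIdx) (x : Site d) :
    (Letters.perc d p).D j₁ j₂ x = bondPercolation (zdGraph d) p (event j₁ 0 x □ event j₂ 0 x) := rfl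
/-- Unfolding `𝓑`. [folklore] -/
theorem perc_B (j₁ j₂ : LenIdx) (x₁ x₂ : Site d) :
    (Letters.perc d p).B j₁ j₂ x₁ x₂ = repLetter d p (lineEvents₂ j₁ j₂ x₁ x₂) := rfl
/-- Unfolding `𝓣`. [folklore] -/
theorem perc_T (j₁ j₂ j₃ : LenIdx) (x₁ x₂ x₃ : Site d) :
    (Letters.perc d p).T j₁ j₂ j₃ x₁ x₂ x₃ = repLetter d p (lineEvents₃ j₁ j₂ j₃ x₁ x₂ x₃) := rfl
/-- Unfolding `𝓢`. [folklore] -/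
theorem perc_S (j₁ j₂ j₃ j₄ : LenIdx) (x₁ x₂ x₃ x₄ : Site d) :
    (Letters.perc d p).S j₁ j₂ j₃ j₄ x₁ x₂ x₃ x₄ = repLetter d p (lineEvents₄ j₁ j₂ j₃ j₄ x₁ x₂ x₃ x₄) := rfl
/-- Unfolding `𝓟`. [folklore] -/
theorem perc_P (j₁ j₂ j₃ j₄ j₅ : LenIdx) (x₁ x₂ x₃ x₄ x₅ : Site d) :
    (Letters.perc d p).P j₁ j₂ j₃ j₄ j₅ x₁ x₂ x₃ x₄ x₅ =
      repLetter d p (lineEvents₅ j₁ j₂ j₃ j₄ j₅ x₁ x₂ x₃ x₄ x₅) := rfl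

end Unfold

/-! ### D. Elementary facts: `≤ 1`, the `τ`-dictionary -/

section Facts

variable (p : unitInterval)

/-- `τ_{j,p}(x)` of the instance is the tree's `tauLetter = ofReal (tauIdx)` (`= ofReal τ_{m,p}` / `ofReal τ_{m̲,p}`).
[cite: FitznerVanDerHofstad2017, §4.2 (4.1), (4.10) (arXiv:1506.07977v2 pp. 34–35)] -/
theorem perc_tau_eq_tauLetter (j : LenIdx) (x : Site d) : (Letters.perc d p).tau j x = tauLetter d p j x := by
  rw [perc_tau, tauLetter, tauIdx_eq_measureReal, ofReal_measureReal (measure_ne_top _ _)]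

/-- `τ_{j,p}(x) ≤ 1`. [folklore] -/
theorem perc_tau_le_one (j : LenIdx) (x : Site d) : (Letters.perc d p).tau j x ≤ 1 := prob_le_one

/-- `ℙ_p(0 ⇔ x) ≤ 1`. [folklore] -/
theorem perc_dbc_le_one (x : Site d) : (Letters.perc d p).dbc x ≤ 1 := prob_le_one

/-- `ℙ_p(0 ⇔ 0) = 1` (empty witnesses). [folklore] -/
theorem perc_dbc_zero : (Letters.perc d p).dbc (0 : Site d) = 1 := by
  rw [perc_dbc]
  have h : (openConn (0 : Site d) 0 □ openConn (0 : Site d) 0 : Set (BondConfig (Site d))) = Set.univ := by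
    refine Set.eq_univ_of_forall fun ω => ⟨∅, ∅, disjoint_bot_left, fun ω' _ => ?_, fun ω' _ => ?_⟩ <;>
      exact SimpleGraph.Reachable.refl _
  rw [h, measure_univ]

/-- `𝓓_{j₁,j₂}(x) ≤ 1`. [folklore] -/
theorem perc_D_le_one (j₁ j₂ : LenIdx) (x : Site d) : (Letters.perc d p).D j₁ j₂ x ≤ 1 := prob_le_one

/-- `𝓑 ≤ 1`. [folklore] -/
theorem perc_B_le_one (j₁ j₂ : LenIdx) (x₁ x₂ : Site d) : (Letters.perc d p).B j₁ j₂ x₁ x₂ ≤ 1 :=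
  by
  rw [perc_B]
  exact repLetter_le_one p _

/-- `𝓣 ≤ 1`. [folklore] -/
theorem perc_T_le_one (j₁ j₂ j₃ : LenIdx) (x₁ x₂ x₃ : Site d) : (Letters.perc d p).T j₁ j₂ j₃ x₁ x₂ x₃ ≤ 1 :=
  by
  rw [perc_T]
  exact repLetter_le_one p _

/-- `𝓢 ≤ 1`. [folklore] -/
theorem perc_S_le_one (j₁ j₂ j₃ j₄ : LenIdx) (x₁ x₂ x₃ x₄ : Site d) :
    (Letters.perc d p).S j₁ j₂ j₃ j₄ x₁ x₂ x₃ x₄ ≤ 1 :=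
  by
  rw [perc_S]
  exact repLetter_le_one p _

/-- `𝓟 ≤ 1`. [folklore] -/
theorem perc_P_le_one (j₁ j₂ j₃ j₄ j₅ : LenIdx) (x₁ x₂ x₃ x₄ x₅ : Site d) :
    (Letters.perc d p).P j₁ j₂ j₃ j₄ j₅ x₁ x₂ x₃ x₄ x₅ ≤ 1 :=
  by
  rw [perc_P]
  exact repLetter_le_one p _

end Facts

/-! ### E. Monotonicity in the indices: exact-length letters are below at-least letters -/

section Floor

variable (p : unitInterval)

/-- `{x ←j→ y} ⊆ {x ←⌊j⌋→ y}` line by line. [cite: FitznerVanDerHofstad2017, §4.2 (4.1) (arXiv:1506.07977v2 p. 34)] -/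
theorem lineEvents₂_subset_floor (j₁ j₂ : LenIdx) (x₁ x₂ : Site d) (i : Fin 2) :
    lineEvents₂ j₁ j₂ x₁ x₂ i ⊆ lineEvents₂ (ge (floor j₁)) (ge (floor j₂)) x₁ x₂ i := by
  fin_cases i <;> exact event_subset_openConnGe _ _ _

/-- `{x ←j→ y} ⊆ {x ←⌊j⌋→ y}` line by line. [cite: FitznerVanDerHofstad2017, §4.2 (4.1) (arXiv:1506.07977v2 p. 34)] -/
theorem lineEvents₃_subset_floor (j₁ j₂ j₃ : LenIdx) (x₁ x₂ x₃ : Site d) (i : Fin 3) :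
    lineEvents₃ j₁ j₂ j₃ x₁ x₂ x₃ i ⊆ lineEvents₃ (ge (floor j₁)) (ge (floor j₂)) (ge (floor j₃)) x₁ x₂ x₃ i := by
  fin_cases i <;> exact event_subset_openConnGe _ _ _

/-- `{x ←j→ y} ⊆ {x ←⌊j⌋→ y}` line by line. [cite: FitznerVanDerHofstad2017, §4.2 (4.1) (arXiv:1506.07977v2 p. 34)] -/
theorem lineEvents₄_subset_floor (j₁ j₂ j₃ j₄ : LenIdx) (x₁ x₂ x₃ x₄ : Site d) (i : Fin 4) :
    lineEvents₄ j₁ j₂ j₃ j₄ x₁ x₂ x₃ x₄ i ⊆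
      lineEvents₄ (ge (floor j₁)) (ge (floor j₂)) (ge (floor j₃)) (ge (floor j₄)) x₁ x₂ x₃ x₄ i := by
  fin_cases i <;> exact event_subset_openConnGe _ _ _

/-- `{x ←j→ y} ⊆ {x ←⌊j⌋→ y}` line by line. [cite: FitznerVanDerHofstad2017, §4.2 (4.1) (arXiv:1506.07977v2 p. 34)] -/
theorem lineEvents₅_subset_floor (j₁ j₂ j₃ j₄ j₅ : LenIdx) (x₁ x₂ x₃ x₄ x₅ : Site d) (i : Fin 5) :
    lineEvents₅ j₁ j₂ j₃ j₄ j₅ x₁ x₂ x₃ x₄ x₅ i ⊆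
      lineEvents₅ (ge (floor j₁)) (ge (floor j₂)) (ge (floor j₃)) (ge (floor j₄)) (ge (floor j₅)) x₁ x₂ x₃ x₄ x₅ i := by
  fin_cases i <;> exact event_subset_openConnGe _ _ _

/-- `τ_{j,p}(x) ≤ τ_{⌊j⌋,p}(x)` (`τ_{m̲,p} ≤ τ_{m,p}`). [cite: FitznerVanDerHofstad2017, §4.2 (4.1) (arXiv:1506.07977v2 p. 34)] -/
theorem perc_tau_le_floor (j : LenIdx) (x : Site d) :
    (Letters.perc d p).tau j x ≤ (Letters.perc d p).tau (ge (floor j)) x :=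
  measure_mono (event_subset_openConnGe j 0 x)

/-- `𝓓_{j₁,j₂} ≤ 𝓓_{⌊j₁⌋,⌊j₂⌋}`. [cite: FitznerVanDerHofstad2017, §4.2 (4.12) (arXiv:1506.07977v2 p. 35)] -/
theorem perc_D_le_floor (j₁ j₂ : LenIdx) (x : Site d) :
    (Letters.perc d p).D j₁ j₂ x ≤ (Letters.perc d p).D (ge (floor j₁)) (ge (floor j₂)) x :=
  measure_mono (disjointOccurrence_mono (event_subset_openConnGe j₁ 0 x) (event_subset_openConnGe j₂ 0 x))

/-- `𝓑_{j₁,j₂} ≤ 𝓑_{⌊j₁⌋,⌊j₂⌋}`. [cite: FitznerVanDerHofstad2017, §4.2 (4.16) (arXiv:1506.07977v2 p. 36)] -/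
theorem perc_B_le_floor (j₁ j₂ : LenIdx) (x₁ x₂ : Site d) :
    (Letters.perc d p).B j₁ j₂ x₁ x₂ ≤ (Letters.perc d p).B (ge (floor j₁)) (ge (floor j₂)) x₁ x₂ :=
  repLetter_mono p (lineEvents₂_subset_floor j₁ j₂ x₁ x₂)

/-- `𝓣_{j₁,j₂,j₃} ≤ 𝓣_{⌊j₁⌋,⌊j₂⌋,⌊j₃⌋}`. [cite: FitznerVanDerHofstad2017, §4.2 (4.17) (arXiv:1506.07977v2 p. 36)] -/
theorem perc_T_le_floor (j₁ j₂ j₃ : LenIdx) (x₁ x₂ x₃ : Site d) :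
    (Letters.perc d p).T j₁ j₂ j₃ x₁ x₂ x₃ ≤
      (Letters.perc d p).T (ge (floor j₁)) (ge (floor j₂)) (ge (floor j₃)) x₁ x₂ x₃ :=
  repLetter_mono p (lineEvents₃_subset_floor j₁ j₂ j₃ x₁ x₂ x₃)

/-- `𝓢_{j} ≤ 𝓢_{⌊j⌋}`. [cite: FitznerVanDerHofstad2017, §4.2, after (4.17) (arXiv:1506.07977v2 p. 36)] -/
theorem perc_S_le_floor (j₁ j₂ j₃ j₄ : LenIdx) (x₁ x₂ x₃ x₄ : Site d) :
    (Letters.perc d p).S j₁ j₂ j₃ j₄ x₁ x₂ x₃ x₄ ≤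
      (Letters.perc d p).S (ge (floor j₁)) (ge (floor j₂)) (ge (floor j₃)) (ge (floor j₄)) x₁ x₂ x₃ x₄ :=
  repLetter_mono p (lineEvents₄_subset_floor j₁ j₂ j₃ j₄ x₁ x₂ x₃ x₄)

/-- `𝓟_{j} ≤ 𝓟_{⌊j⌋}`. [cite: FitznerVanDerHofstad2017, §4.2, after (4.17) (arXiv:1506.07977v2 p. 36)] -/
theorem perc_P_le_floor (j₁ j₂ j₃ j₄ j₅ : LenIdx) (x₁ x₂ x₃ x₄ x₅ : Site d) :
    (Letters.perc d p).P j₁ j₂ j₃ j₄ j₅ x₁ x₂ x₃ x₄ x₅ ≤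
      (Letters.perc d p).P (ge (floor j₁)) (ge (floor j₂)) (ge (floor j₃)) (ge (floor j₄)) (ge (floor j₅))
        x₁ x₂ x₃ x₄ x₅ :=
  repLetter_mono p (lineEvents₅_subset_floor j₁ j₂ j₃ j₄ j₅ x₁ x₂ x₃ x₄ x₅)

end Floor

/-! ### F. The product bounds (4.14)–(4.15): `𝓑 ≤ 𝓑*`, `𝓣 ≤ 𝓣*`, `𝓢 ≤ 𝓢*` -/

section Product

variable (p : unitInterval)

/-- `ℙ_p(x ←j→ y) = τ_{j,p}(y − x)` in the instance's currency. [cite: FitznerVanDerHofstad2017, §4.2 (4.1) (arXiv:1506.07977v2 p. 34)] -/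
theorem measure_event_eq_perc_tau (j : LenIdx) (x y : Site d) :
    bondPercolation (zdGraph d) p (event j x y) = (Letters.perc d p).tau j (y - x) := by
  rw [perc_tau_eq_tauLetter, tauLetter, ← measureReal_event_eq_tauIdx, ofReal_measureReal (measure_ne_top _ _)]

/-- **`𝓑_{j₁,j₂}(x₁,x₂) ≤ 𝓑*_{j₁,j₂}(x₁,x₂) = τ_{j₁}(x₁) τ_{j₂}(x₂ − x₁)`** ((4.14)–(4.15) with (4.7)).
[cite: FitznerVanDerHofstad2017, §4.2 (4.7), (4.14)–(4.16) (arXiv:1506.07977v2 pp. 34–36)] -/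
theorem perc_B_le_Bst (j₁ j₂ : LenIdx) (x₁ x₂ : Site d) :
    (Letters.perc d p).B j₁ j₂ x₁ x₂ ≤ (Letters.perc d p).Bst j₁ j₂ x₁ x₂ := by
  classical
  rw [perc_B]
  refine (repLetter_le_prod p _ (fun i => by fin_cases i <;> exact isUpperSet_event _ _ _)
    (fun i => by fin_cases i <;> exact isFinitary_event _ _ _)).trans_eq ?_
  rw [Fin.prod_univ_two]
  simp only [lineEvents₂, Matrix.cons_val_zero, Matrix.cons_val_one, measure_event_eq_perc_tau,
    sub_zero, Letters.Bst]

/-- **`𝓣_{j₁,j₂,j₃}(x₁,x₂,x₃) ≤ 𝓣*_{j₁,j₂,j₃}(x₁,x₂,x₃) = τ_{j₁}(x₁) τ_{j₂}(x₂ − x₁) τ_{j₃}(x₃ − x₂)`** ((4.14)–(4.15)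
with (4.8)). [cite: FitznerVanDerHofstad2017, §4.2 (4.8), (4.14)–(4.17) (arXiv:1506.07977v2 pp. 34–36)] -/
theorem perc_T_le_Tst (j₁ j₂ j₃ : LenIdx) (x₁ x₂ x₃ : Site d) :
    (Letters.perc d p).T j₁ j₂ j₃ x₁ x₂ x₃ ≤ (Letters.perc d p).Tst j₁ j₂ j₃ x₁ x₂ x₃ := by
  classical
  rw [perc_T]
  refine (repLetter_le_prod p _ (fun i => by fin_cases i <;> exact isUpperSet_event _ _ _)
    (fun i => by fin_cases i <;> exact isFinitary_event _ _ _)).trans_eq ?_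
  rw [Fin.prod_univ_three]
  simp only [lineEvents₃, Matrix.cons_val_zero, Matrix.cons_val_one, Matrix.cons_val_two, Matrix.head_cons,
    Matrix.tail_cons, measure_event_eq_perc_tau, sub_zero, Letters.Tst, Letters.Bst]

/-- **`𝓢_{j}(x₁,…,x₄) ≤ 𝓢*_{j}(x₁,…,x₄) = τ τ τ τ`** ((4.14)–(4.15) with (4.9)).
[cite: FitznerVanDerHofstad2017, §4.2 (4.9), (4.14)–(4.15) (arXiv:1506.07977v2 pp. 34–36)] -/
theorem perc_S_le_Sst (j₁ j₂ j₃ j₄ : LenIdx) (x₁ x₂ x₃ x₄ : Site d) :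
    (Letters.perc d p).S j₁ j₂ j₃ j₄ x₁ x₂ x₃ x₄ ≤ (Letters.perc d p).Sst j₁ j₂ j₃ j₄ x₁ x₂ x₃ x₄ := by
  classical
  rw [perc_S]
  refine (repLetter_le_prod p _ (fun i => by fin_cases i <;> exact isUpperSet_event _ _ _)
    (fun i => by fin_cases i <;> exact isFinitary_event _ _ _)).trans_eq ?_
  rw [Fin.prod_univ_four]
  simp only [lineEvents₄, Matrix.cons_val_zero, Matrix.cons_val_one, Matrix.cons_val_two, Matrix.head_cons,
    Matrix.tail_cons, measure_event_eq_perc_tau, sub_zero, Letters.Sst, Letters.Tst, Letters.Bst]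
  have h3 : (![event j₁ 0 x₁, event j₂ x₁ x₂, event j₃ x₂ x₃, event j₄ x₃ x₄] :
      Fin 4 → Set (BondConfig (Site d))) 3 = event j₄ x₃ x₄ := rfl
  rw [h3, measure_event_eq_perc_tau]

end Product

/-! ### G. Dictionary with the tree's at-least-indexed diagrams -/

section Dictionary

variable (p : unitInterval)

/-- `τ_{(ge m)}` of the instance is `ofReal τ_{m,p}` (`NobleBoundsN0.tauGe`). [cite: FitznerVanDerHofstad2017, §4.2 (4.1) (arXiv:1506.07977v2 p. 34)] -/
theorem perc_tau_ge (m : ℕ) (x : Site d) : (Letters.perc d p).tau (ge m) x = ENNReal.ofReal (tauGe d p m x) := by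
  rw [perc_tau_eq_tauLetter, tauLetter, tauIdx_ge]

/-- `τ_{(eq m)}` of the instance is `ofReal τ_{m̲,p}` (`NobleExactLengthLines.tauEq`). [cite: FitznerVanDerHofstad2017, §4.2 (4.1) (arXiv:1506.07977v2 p. 34)] -/
theorem perc_tau_eqIdx (m : ℕ) (x : Site d) : (Letters.perc d p).tau (eq m) x = ENNReal.ofReal (tauEq d p m x) := by
  rw [perc_tau_eq_tauLetter, tauLetter, tauIdx_eq]

/-- `𝓓_{m₁,m₂}` of the instance is the tree's `diagDT` (`NobleBoundsN0`). [cite: FitznerVanDerHofstad2017, §4.2 (4.12) (arXiv:1506.07977v2 p. 35)] -/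
theorem perc_D_ge (m₁ m₂ : ℕ) (x : Site d) : (Letters.perc d p).D (ge m₁) (ge m₂) x = diagDT d p m₁ m₂ x := rfl

/-- The members of (4.17) agree: `ℙ_p^{⊗3}(⊛ lines with assignment c)` of the instance is `ofReal (diagTL d 3 p c …)` of
`RepulsiveTriangleExtractionIndep` (at-least indices). [cite: FitznerVanDerHofstad2017, §4.2 (4.17) (arXiv:1506.07977v2 p. 36)] -/
theorem piPerc_genDisjOcc_lineEvents₃_ge (c : Fin 3 → Fin 3) (m₁ m₂ m₃ : ℕ) (x₁ x₂ x₃ : Site d) :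
    piPerc d p 3 (genDisjOcc (lineEvents₃ (ge m₁) (ge m₂) (ge m₃) x₁ x₂ x₃) c) =
      ENNReal.ofReal (diagTL d 3 p c m₁ m₂ m₃ x₁ x₂ x₃) := by
  rw [diagTL, genDisjConnN_eq_genDisjOcc]
  have hA : (fun i => (triLines c m₁ m₂ m₃ x₁ x₂ x₃ i).event) = lineEvents₃ (ge m₁) (ge m₂) (ge m₃) x₁ x₂ x₃ := by
    funext i
    fin_cases i <;> rfl
  have hc : (fun i => (triLines c m₁ m₂ m₃ x₁ x₂ x₃ i).c) = c := by
    funext i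
    fin_cases i <;> rfl
  rw [hA, hc, piPerc, ofReal_measureReal (measure_ne_top _ _)]

/-- **`𝓣_{m₁,m₂,m₃}` of the instance is `ofReal (repTriangle d p m₁ m₂ m₃)`** — the same maximum over `{1,2,3}²`.
[cite: FitznerVanDerHofstad2017, §4.2 (4.17) (arXiv:1506.07977v2 p. 36)] -/
theorem perc_T_ge (m₁ m₂ m₃ : ℕ) (x₁ x₂ x₃ : Site d) :
    (Letters.perc d p).T (ge m₁) (ge m₂) (ge m₃) x₁ x₂ x₃ = ENNReal.ofReal (repTriangle d p m₁ m₂ m₃ x₁ x₂ x₃) := by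
  rw [perc_T, repLetter, repTriangle]
  apply le_antisymm
  · refine Finset.sup_le fun c hc => ?_
    rw [mem_assignments_iff] at hc
    have hcv : c = ![0, c 1, c 2] := by
      funext i
      fin_cases i
      · exact hc
      · rfl
      · rfl
    rw [piPerc_genDisjOcc_lineEvents₃_ge, hcv]
    refine ENNReal.ofReal_le_ofReal ?_
    exact Finset.le_sup' (f := fun ij : Fin 3 × Fin 3 => diagTL d 3 p ![0, ij.1, ij.2] m₁ m₂ m₃ x₁ x₂ x₃)
      (Finset.mem_univ (c 1, c 2))
  · obtain ⟨ij, -, hij⟩ := Finset.exists_mem_eq_sup' (Finset.univ_nonempty (α := Fin 3 × Fin 3))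
      (fun ij : Fin 3 × Fin 3 => diagTL d 3 p ![0, ij.1, ij.2] m₁ m₂ m₃ x₁ x₂ x₃)
    rw [hij, ← piPerc_genDisjOcc_lineEvents₃_ge]
    exact piPerc_genDisjOcc_le_repLetter p _ (c := ![0, ij.1, ij.2]) rfl

end Dictionary

end Literature.Probability.FitznerVanDerHofstad2017.NobleBlocks

end
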